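import Literature.MathematicalPhysics.QuantumFieldTheory.Balaban1983to89.T4HaarSU2LocalDiffeo
import Literature.MathematicalPhysics.QuantumFieldTheory.Balaban1983to89.MatrixLog
import Literature.Analysis.SpecialFunctions.ExpFDeriv
import Mathlib.Analysis.Normed.Algebra.QuaternionExponential
import Mathlib.Analysis.SpecialFunctions.Trigonometric.Sinc
import HarnessLib

/-!
# T4QuatExpLog — the quaternion model of `exp` / `log` near `SU(2)` and the left-trivialised differential of the
# logarithm (pub-balaban, row T4-D.G-EML-K3-FIBRE*, leaf A)

Pure calculus over Mathlib (`Quaternion.exp_of_re_eq_zero`, the tree's series logarithm `MatrixLog.mlog` (21) and the Fréchet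
derivative of `exp` of `Literature.Analysis.SpecialFunctions.ExpFDeriv`); no Bałaban content, every declaration is [folklore].
PURPOSE ONLY (no journal text is typed here): kernel rows (K3) "exp/log Fréchet calculus" and the algebraic half of the
certificate (E1)–(E4) of the cell record `HOME/b2b-balaban-pv03/EML-HAARAC.md` (§3, §5) toward the OPEN off-spine node
`T4ApexTwoLevel.BlockHaarAC F ExpMeanLog.expMeanLogSU` — absolute continuity of the block-averaging push-forward for the PRINTED
exp-mean-log small-loop average of [Balaban1987RG1] (0.4) p. 253 on `SU(2)` — done in the QUATERNION MODEL `ℍ ≃ ℝ⁴ ⊃ S³ = SU(2)` of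
`T4HaarSU2Translate` / `T4HaarSU2LocalDiffeo`, where the one-variable law of that average becomes an explicit real-analytic map
`u ↦ exp (Σ_i c_i • qlog (a_i ū)) · u` whose tangent differential leaf B (`T4EMLFibreAC`) shows to be injective.

CONTENT.
* §1 The dictionary `quatMatrix : ℍ → M₂(ℂ)` is an `L²`-operator-norm isometry (`norm_quatMatrix`) and a continuous ring
  homomorphism, hence INTERTWINES THE EXPONENTIALS (`quatMatrix_exp`, Mathlib `map_exp`); its range is closed, so the series
  logarithm of a quaternion matrix is a quaternion matrix (`mlog_quatMatrix_mem_range`).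
* §2 The quaternion logarithm `qlog u := topRowQuat (mlog (quatMatrix u))` on `‖u − 1‖ < 1`: `quatMatrix (qlog u) = mlog (quatMatrix u)`,
  `exp (qlog u) = u`, `‖qlog u‖ ≤ ‖u − 1‖/(1 − ‖u − 1‖)` (`< 1` for `‖u − 1‖ < 1/2`), `re (qlog u) = log ‖u‖` (imaginary on units),
  differentiability / smoothness (chain rule through the analytic `mlog`), and the inverse relations
  `D exp(qlog u) ∘ D qlog(u) = id = D qlog(u) ∘ D exp(qlog u)` (differentiate `exp ∘ qlog = id`; finite dimension).
* §3 The structure of `D exp(w)` at an IMAGINARY `w`, `θ = ‖w‖`: `D exp(w) h = h e^w` on directions commuting with `w` (ExpFDeriv) and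
  `D exp(w) h = sinc θ • h` on directions ANTICOMMUTING with `w` (`fderiv_exp_apply_of_anticommute`: in the derivative series the
  inner sums `Σ_i w^{n−1−i} h w^i` collapse to `h w^{n−1}` for odd `n` and vanish for even `n`, `w² = −θ²`, and
  `Σ_k (−1)^k θ^{2k}/(2k+1)! = sinc θ`), in particular on imaginary `h ⊥ w`.
* §4 The LEFT-TRIVIALISED DIFFERENTIAL OF THE LOGARITHM.  With `x_∥ = par_w x`, `x_⊥ = perp_w x` and `ψ(θ) = 1 − θ cot θ`
  (`:= 1 − cos θ / sinc θ`), `N_w x := x_∥ + (1 − ψ θ) x_⊥ + w x_⊥` satisfies the KEY IDENTITY `D exp(w) (N_w x) = e^w x` for imaginary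
  `w, x`, `θ < π` (`fderiv_exp_apply_N`); `D exp(w)` is injective for imaginary `w` with `θ < π` (`fderiv_exp_injective_of_re_eq_zero`);
  hence `D qlog(u) (u x) = N_{qlog u} x` for unit `u` with `‖u − 1‖ < 1/2` and imaginary `x` (`fderiv_qlog_apply_mul`); and the
  QUADRATIC FORM `⟪N_w x, x⟫ = ‖x‖² − ψ(θ) ‖x_⊥‖²` (`inner_N_self`).  Also `‖e^w − 1‖ ≤ ‖w‖` for imaginary `w`.

VALUE = kernel calculus in the quaternion model (an engine for a named open node); NOT an estimate of the papers, NOT summit progress.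
-/

noncomputable section

open NormedSpace Set Metric Function Filter
open scoped RealInnerProductSpace Topology Quaternion

namespace Literature.MathematicalPhysics.QuantumFieldTheory.Balaban1983to89.T4QuatExpLog

open Literature.MathematicalPhysics.QuantumLattice (quatMatrix quatMatrix_apply_00 quatMatrix_apply_01 quatMatrix_apply_10
  quatMatrix_apply_11 quatMatrix_mul quatMatrix_one quatMatrix_smul quatMatrix_neg star_quatMatrix_mul_self continuous_quatMatrix)
open Literature.Geometry.GaugeTheory (quatMatrix_add quatMatrix_zero quatMatrix_star quatMatrixLinear quatMatrixLinear_apply)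
open T4HaarSU2LocalDiffeo (topRowQuat topRowQuat_quatMatrix quatMatrixCLM quatMatrixCLM_apply)
open Literature.Analysis.Complex (logSeriesCoeff)

/-! ## 1. The dictionary `ℍ → M₂(ℂ)`: norm, ring structure, `exp` -/

section Dictionary

open scoped Matrix.Norms.L2Operator

/-- `quatMatrix (p - q) = quatMatrix p - quatMatrix q`. [folklore] -/
theorem quatMatrix_sub (p q : ℍ) : quatMatrix (p - q) = quatMatrix p - quatMatrix q := by
  rw [sub_eq_add_neg, quatMatrix_add, quatMatrix_neg, ← sub_eq_add_neg]

/-- `quatMatrix` is an isometry for the `L²`-operator norm: `‖quatMatrix q‖ = ‖q‖` (C⋆-identity and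
`(quatMatrix q)ᴴ quatMatrix q = ‖q‖² · 1`). [folklore] -/
theorem norm_quatMatrix (q : ℍ) : ‖quatMatrix q‖ = ‖q‖ := by
  have h : ‖quatMatrix q‖ * ‖quatMatrix q‖ = ‖q‖ * ‖q‖ := by
    rw [← Matrix.l2_opNorm_conjTranspose_mul_self, ← Matrix.star_eq_conjTranspose, star_quatMatrix_mul_self,
      norm_smul, Complex.norm_real, Real.norm_of_nonneg Quaternion.normSq_nonneg, norm_one, mul_one,
      Quaternion.normSq_eq_norm_mul_self]
  have h1 : 0 ≤ ‖quatMatrix q‖ := norm_nonneg _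
  have h2 : 0 ≤ ‖q‖ := norm_nonneg _
  nlinarith [sq_nonneg (‖quatMatrix q‖ - ‖q‖), sq_nonneg (‖quatMatrix q‖ + ‖q‖)]

/-- `‖quatMatrix q - 1‖ = ‖q - 1‖`. [folklore] -/
theorem norm_quatMatrix_sub_one (q : ℍ) : ‖quatMatrix q - 1‖ = ‖q - 1‖ := by
  rw [← quatMatrix_one, ← quatMatrix_sub, norm_quatMatrix]

/-- `quatMatrix` as a ring homomorphism `ℍ →+* M₂(ℂ)`. [folklore] -/
def quatMatrixRingHom : ℍ →+* Matrix (Fin 2) (Fin 2) ℂ where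
  toFun := quatMatrix
  map_one' := quatMatrix_one
  map_mul' := quatMatrix_mul
  map_zero' := quatMatrix_zero
  map_add' := quatMatrix_add

/-- `quatMatrixRingHom` is `quatMatrix`. [folklore] -/
@[simp] theorem quatMatrixRingHom_apply (q : ℍ) : quatMatrixRingHom q = quatMatrix q := rfl

/-- `quatMatrix` INTERTWINES THE EXPONENTIALS: `quatMatrix (exp q) = exp (quatMatrix q)` (a continuous ring homomorphism
commutes with `NormedSpace.exp`, Mathlib `map_exp`). [folklore] -/
theorem quatMatrix_exp (q : ℍ) : quatMatrix (exp q) = exp (quatMatrix q) := by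
  letI : NormedAlgebra ℚ ℍ := NormedAlgebra.restrictScalars ℚ ℝ ℍ
  exact map_exp quatMatrixRingHom continuous_quatMatrix q

/-- `quatMatrix` of a power. [folklore] -/
theorem quatMatrix_pow (q : ℍ) (n : ℕ) : quatMatrix (q ^ n) = quatMatrix q ^ n :=
  map_pow quatMatrixRingHom q n

/-- The range of `quatMatrix` is closed (a finite-dimensional real subspace of `M₂(ℂ)`). [folklore] -/
theorem isClosed_range_quatMatrix : IsClosed (Set.range quatMatrix) := by
  have h : Set.range quatMatrix = (LinearMap.range quatMatrixLinear : Set (Matrix (Fin 2) (Fin 2) ℂ)) := by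
    ext M; simp [LinearMap.mem_range]
  rw [h]
  exact (LinearMap.range quatMatrixLinear).closed_of_finiteDimensional

/-- For `‖u − 1‖ < 1` the series logarithm of `quatMatrix u` is again a quaternion matrix (every partial sum of the series
(21) is one, and the range of `quatMatrix` is closed). [folklore] -/
theorem mlog_quatMatrix_mem_range {u : ℍ} (hu : ‖u - 1‖ < 1) : MatrixLog.mlog (quatMatrix u) ∈ Set.range quatMatrix := by
  have hu' : ‖quatMatrix u - 1‖ < 1 := by rwa [norm_quatMatrix_sub_one]
  have hs := MatrixLog.hasSum_mlog hu'
  refine isClosed_range_quatMatrix.mem_of_tendsto hs.tendsto_sum_nat (Eventually.of_forall fun N => ?_)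
  refine ⟨∑ n ∈ Finset.range N, ((logSeriesCoeff n).re) • (u - 1) ^ n, ?_⟩
  rw [T4HaarSU2Translate.quatMatrix_sum]
  refine Finset.sum_congr rfl fun n _ => ?_
  have hre : ((logSeriesCoeff n).re : ℂ) = logSeriesCoeff n := by
    rw [show logSeriesCoeff n = (((-1 : ℝ) ^ (n + 1) / n : ℝ) : ℂ) by simp [logSeriesCoeff], Complex.ofReal_re]
  rw [quatMatrix_smul, quatMatrix_pow, quatMatrix_sub, quatMatrix_one, hre]

end Dictionary

/-! ## 2. The quaternion logarithm on the ball `‖u − 1‖ < 1` -/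

section Log

open scoped Matrix.Norms.L2Operator

/-- The QUATERNION LOGARITHM: the series logarithm (21) `mlog` of `quatMatrix u`, read back in `ℍ` through the first row.
Meaningful for `‖u − 1‖ < 1`. [folklore] -/
def qlog (u : ℍ) : ℍ := topRowQuat (MatrixLog.mlog (quatMatrix u))

/-- `quatMatrix (qlog u) = mlog (quatMatrix u)` for `‖u − 1‖ < 1`: the dictionary intertwines the logarithms. [folklore] -/
theorem quatMatrix_qlog {u : ℍ} (hu : ‖u - 1‖ < 1) : quatMatrix (qlog u) = MatrixLog.mlog (quatMatrix u) := by
  obtain ⟨q, hq⟩ := mlog_quatMatrix_mem_range hu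
  rw [qlog, ← hq, topRowQuat_quatMatrix]

/-- `exp (qlog u) = u` for `‖u − 1‖ < 1`. [folklore] -/
theorem exp_qlog {u : ℍ} (hu : ‖u - 1‖ < 1) : exp (qlog u) = u := by
  apply (Function.LeftInverse.injective topRowQuat_quatMatrix : Function.Injective quatMatrix)
  rw [quatMatrix_exp, quatMatrix_qlog hu, MatrixLog.exp_mlog (by rwa [norm_quatMatrix_sub_one])]

/-- `qlog 1 = 0`. [folklore] -/
@[simp] theorem qlog_one : qlog 1 = 0 := by
  rw [qlog, quatMatrix_one, MatrixLog.mlog_one, map_zero]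

/-- `‖qlog u‖ ≤ ‖u − 1‖ / (1 − ‖u − 1‖)` for `‖u − 1‖ < 1`. [folklore] -/
theorem norm_qlog_le {u : ℍ} (hu : ‖u - 1‖ < 1) : ‖qlog u‖ ≤ ‖u - 1‖ / (1 - ‖u - 1‖) := by
  rw [← norm_quatMatrix, quatMatrix_qlog hu, ← norm_quatMatrix_sub_one]
  exact MatrixLog.norm_mlog_le_div (by rwa [norm_quatMatrix_sub_one])

/-- `‖qlog u‖ < 1` for `‖u − 1‖ < 1/2`. [folklore] -/
theorem norm_qlog_lt_one {u : ℍ} (hu : ‖u - 1‖ < 1 / 2) : ‖qlog u‖ < 1 := by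
  have hu1 : ‖u - 1‖ < 1 := lt_trans hu (by norm_num)
  refine lt_of_le_of_lt (norm_qlog_le hu1) ?_
  rw [div_lt_one (by linarith)]
  linarith

/-- The real part of the logarithm: `re (qlog u) = log ‖u‖` (`‖exp q‖ = e^{re q}`). [folklore] -/
theorem qlog_re {u : ℍ} (hu : ‖u - 1‖ < 1) : (qlog u).re = Real.log ‖u‖ := by
  have h := Quaternion.norm_exp (qlog u)
  rw [exp_qlog hu, ← congrFun Real.exp_eq_exp_ℝ (qlog u).re, Real.norm_eq_abs, Real.abs_exp] at h
  rw [h, Real.log_exp]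

/-- On unit quaternions the logarithm is purely imaginary. [folklore] -/
theorem qlog_re_of_norm_eq_one {u : ℍ} (hu1 : ‖u‖ = 1) (hu : ‖u - 1‖ < 1) : (qlog u).re = 0 := by
  rw [qlog_re hu, hu1, Real.log_one]

/-- `qlog` has a Fréchet derivative at every `u` with `‖u − 1‖ < 1` (chain rule through the analytic `mlog`). [folklore] -/
theorem hasFDerivAt_qlog {u : ℍ} (hu : ‖u - 1‖ < 1) : HasFDerivAt qlog (fderiv ℝ qlog u) u := by
  have hu' : ‖quatMatrix u - 1‖ < 1 := by rwa [norm_quatMatrix_sub_one]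
  have hm : DifferentiableAt ℝ MatrixLog.mlog (quatMatrix u) :=
    ((MatrixLog.analyticAt_mlog hu').differentiableAt).restrictScalars ℝ
  have h : DifferentiableAt ℝ qlog u :=
    topRowQuat.differentiableAt.comp u (hm.comp u quatMatrixCLM.differentiableAt)
  exact h.hasFDerivAt

/-- `qlog` is real-analytic (hence `C^∞`) at every `u` with `‖u − 1‖ < 1`. [folklore] -/
theorem contDiffAt_qlog {u : ℍ} (hu : ‖u - 1‖ < 1) {n : WithTop ℕ∞} : ContDiffAt ℝ n qlog u := by
  have hu' : ‖quatMatrix u - 1‖ < 1 := by rwa [norm_quatMatrix_sub_one]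
  have hm : ContDiffAt ℝ n MatrixLog.mlog (quatMatrix u) :=
    ((MatrixLog.analyticAt_mlog hu').contDiffAt).restrict_scalars ℝ
  exact topRowQuat.contDiff.contDiffAt.comp u (hm.comp u quatMatrixCLM.contDiff.contDiffAt)

/-- THE KEY RELATION `D exp(qlog u) ∘ D qlog(u) = id` (differentiate `exp ∘ qlog = id` on the open ball `‖u − 1‖ < 1`;
uniqueness of the derivative). [folklore] -/
theorem fderiv_exp_comp_fderiv_qlog {u : ℍ} (hu : ‖u - 1‖ < 1) :
    (fderiv ℝ exp (qlog u)).comp (fderiv ℝ qlog u) = ContinuousLinearMap.id ℝ ℍ := by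
  have hexp : HasFDerivAt (exp : ℍ → ℍ) (fderiv ℝ exp (qlog u)) (qlog u) :=
    (Literature.Analysis.SpecialFunctions.ExpFDeriv.differentiableAt_exp ℝ (qlog u)).hasFDerivAt
  have hcomp : HasFDerivAt (fun v => exp (qlog v)) ((fderiv ℝ exp (qlog u)).comp (fderiv ℝ qlog u)) u :=
    hexp.comp u (hasFDerivAt_qlog hu)
  have hev : (fun v => exp (qlog v)) =ᶠ[𝓝 u] id := by
    have hopen : IsOpen {v : ℍ | ‖v - 1‖ < 1} := isOpen_lt (continuous_id.sub continuous_const).norm continuous_const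
    filter_upwards [hopen.mem_nhds hu] with v hv using exp_qlog hv
  exact (hcomp.congr_of_eventuallyEq hev.symm).unique (hasFDerivAt_id u)

/-- Hence `D qlog(u) ∘ D exp(qlog u) = id` as well (finite dimension). [folklore] -/
theorem fderiv_qlog_comp_fderiv_exp {u : ℍ} (hu : ‖u - 1‖ < 1) :
    (fderiv ℝ qlog u).comp (fderiv ℝ exp (qlog u)) = ContinuousLinearMap.id ℝ ℍ := by
  have h := fderiv_exp_comp_fderiv_qlog hu
  have h' : (fderiv ℝ exp (qlog u) : ℍ →ₗ[ℝ] ℍ) * (fderiv ℝ qlog u : ℍ →ₗ[ℝ] ℍ) = 1 := by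
    rw [Module.End.mul_eq_comp, ← ContinuousLinearMap.toLinearMap_comp, h, ContinuousLinearMap.coe_id, Module.End.one_eq_id]
  rw [mul_eq_one_comm] at h'
  apply ContinuousLinearMap.coe_injective
  rw [ContinuousLinearMap.toLinearMap_comp, ContinuousLinearMap.coe_id, ← Module.End.mul_eq_comp, ← Module.End.one_eq_id]
  exact h'

/-- Applied form: `D qlog(u) (D exp(qlog u) y) = y`. [folklore] -/
theorem fderiv_qlog_apply_fderiv_exp {u : ℍ} (hu : ‖u - 1‖ < 1) (y : ℍ) :
    fderiv ℝ qlog u (fderiv ℝ exp (qlog u) y) = y := by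
  simpa using congrArg (fun f : ℍ →L[ℝ] ℍ => f y) (fderiv_qlog_comp_fderiv_exp hu)

/-- In particular `D exp(qlog u)` is injective. [folklore] -/
theorem fderiv_exp_injective {u : ℍ} (hu : ‖u - 1‖ < 1) : Function.Injective (fderiv ℝ exp (qlog u)) :=
  fun a b hab => by simpa [fderiv_qlog_apply_fderiv_exp hu] using congrArg (fderiv ℝ qlog u) hab

end Log

/-! ## 3. The structure of `D exp` at an imaginary quaternion -/

section ExpDeriv

open scoped Nat

/-- `exp : ℍ → ℍ` has a Fréchet derivative everywhere (power series, `ExpFDeriv`). [folklore] -/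
theorem hasFDerivAt_exp (w : ℍ) : HasFDerivAt (exp : ℍ → ℍ) (fderiv ℝ exp w) w :=
  (Literature.Analysis.SpecialFunctions.ExpFDeriv.differentiableAt_exp ℝ w).hasFDerivAt


/-- Commuting directions: `D exp(w) h = h · exp w` when `w h = h w`. [folklore] -/
theorem fderiv_exp_apply_of_commute {w h : ℍ} (hwh : Commute w h) : fderiv ℝ exp w h = h * exp w := by
  rw [Literature.Analysis.SpecialFunctions.ExpFDeriv.fderiv_exp ℝ w]
  exact Literature.Analysis.SpecialFunctions.ExpFDeriv.fderiv_exp_apply_of_commute ℝ hwh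

/-- The power series of `sinc`: `Σ_k (−1)^k θ^{2k} / (2k+1)! = sinc θ`. [folklore] -/
theorem hasSum_sinc (θ : ℝ) :
    HasSum (fun k : ℕ => (-1 : ℝ) ^ k * θ ^ (2 * k) / (2 * k + 1)!) (Real.sinc θ) := by
  rcases eq_or_ne θ 0 with rfl | hθ
  · have h0 : ∀ k ≠ 0, (-1 : ℝ) ^ k * (0 : ℝ) ^ (2 * k) / (2 * k + 1)! = 0 := fun k hk => by simp [hk]
    simpa [Real.sinc_zero] using hasSum_single 0 h0
  · rw [Real.sinc_of_ne_zero hθ]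
    have h := (Real.hasSum_sin θ).div_const θ
    have hf : (fun k : ℕ => (-1 : ℝ) ^ k * θ ^ (2 * k + 1) / (2 * k + 1)! / θ)
        = fun k => (-1 : ℝ) ^ k * θ ^ (2 * k) / (2 * k + 1)! := by
      funext k; rw [pow_succ]; field_simp
    rwa [hf] at h

/-- ANTICOMMUTING DIRECTIONS: `D exp(w) h = sinc ‖w‖ • h` when `w` is imaginary and `w h = −h w` (the inner sums of the derivative
series collapse to `h w^{n−1}` for odd `n` and vanish for even `n`; `w² = −‖w‖²`). [folklore] -/
theorem fderiv_exp_apply_of_anticommute {w h : ℍ} (hw : w.re = 0) (hwh : w * h = -(h * w)) :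
    fderiv ℝ exp w h = Real.sinc ‖w‖ • h := by
  rw [Literature.Analysis.SpecialFunctions.ExpFDeriv.fderiv_exp ℝ w,
    Literature.Analysis.SpecialFunctions.ExpFDeriv.fderiv_exp_apply ℝ]
  -- `w^m h = (−1)^m h w^m`
  have hpow : ∀ m : ℕ, w ^ m * h = ((-1 : ℝ) ^ m) • (h * w ^ m) := by
    intro m
    induction m with
    | zero => simp
    | succ m ih =>
      calc w ^ (m + 1) * h = w ^ m * (w * h) := by rw [pow_succ, mul_assoc]
        _ = -(w ^ m * h * w) := by rw [hwh, mul_neg, mul_assoc]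
        _ = ((-1 : ℝ) ^ (m + 1)) • (h * w ^ (m + 1)) := by
          rw [ih, smul_mul_assoc, mul_assoc, ← pow_succ, pow_succ (-1 : ℝ), mul_neg_one, neg_smul]
  -- the collapsed general term
  set F : ℕ → ℍ := fun n => ((n ! : ℝ)⁻¹ * ∑ i ∈ Finset.range n, (-1 : ℝ) ^ i) • (h * w ^ (n - 1)) with hF_def
  have hterm : ∀ n : ℕ, ((n !⁻¹ : ℝ) • ∑ i ∈ Finset.range n, w ^ (n.pred - i) * h * w ^ i) = F n := by
    intro n
    have hi : ∀ i ∈ Finset.range n, w ^ (n.pred - i) * h * w ^ i = ((-1 : ℝ) ^ (n - 1 - i)) • (h * w ^ (n - 1)) := by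
      intro i hi
      have hi' : i < n := Finset.mem_range.1 hi
      rw [Nat.pred_eq_sub_one, hpow, smul_mul_assoc, mul_assoc, ← pow_add, Nat.sub_add_cancel (by omega)]
    rw [Finset.sum_congr rfl hi, ← Finset.sum_smul, smul_smul, hF_def, Finset.sum_range_reflect (fun j => (-1 : ℝ) ^ j) n]
  rw [tsum_congr hterm]
  -- even terms vanish, odd terms give the `sinc` series
  have heven : ∀ k : ℕ, F (2 * k) = 0 := fun k => by
    simp only [hF_def, neg_one_geom_sum, even_two_mul, if_true, mul_zero, zero_smul]
  have hodd : ∀ k : ℕ, F (2 * k + 1) = ((-1 : ℝ) ^ k * ‖w‖ ^ (2 * k) / (2 * k + 1)!) • h := by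
    intro k
    have hw2 : w ^ (2 * k) = (((-1 : ℝ) ^ k * ‖w‖ ^ (2 * k) : ℝ) : ℍ) := by
      rw [pow_mul, Quaternion.sq_eq_neg_normSq.2 hw, neg_pow, Quaternion.normSq_eq_norm_mul_self, pow_mul, sq]
      push_cast
      rfl
    have hne : ¬ Even (2 * k + 1) := Nat.not_even_iff_odd.2 (odd_two_mul_add_one k)
    simp only [hF_def, neg_one_geom_sum, hne, if_false, mul_one, Nat.add_sub_cancel, hw2, Quaternion.mul_coe_eq_smul,
      smul_smul]
    congr 1
    ring
  have hsum : HasSum F ((0 : ℍ) + Real.sinc ‖w‖ • h) := by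
    refine HasSum.even_add_odd ?_ ?_
    · simp only [heven]; exact hasSum_zero
    · simp only [hodd]; exact (hasSum_sinc ‖w‖).smul_const h
  rw [hsum.tsum_eq, zero_add]

/-- Imaginary orthogonal quaternions anticommute: `w h = −h w`. [folklore] -/
theorem mul_eq_neg_mul_of_inner_eq_zero {w h : ℍ} (hw : w.re = 0) (hh : h.re = 0) (hwh : ⟪w, h⟫ = 0) :
    w * h = -(h * w) := by
  have h0 : w.imI * h.imI + w.imJ * h.imJ + w.imK * h.imK = 0 := by
    rw [Quaternion.inner_def] at hwh
    simp only [Quaternion.re_mul, Quaternion.re_star, Quaternion.imI_star, Quaternion.imJ_star,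
      Quaternion.imK_star, hw, hh] at hwh
    linarith
  ext <;> simp [hw, hh] <;> linarith

/-- ORTHOGONAL IMAGINARY DIRECTIONS: `D exp(w) h = sinc ‖w‖ • h` for imaginary `w ⊥ h`. [folklore] -/
theorem fderiv_exp_apply_of_inner_eq_zero {w h : ℍ} (hw : w.re = 0) (hh : h.re = 0) (hwh : ⟪w, h⟫ = 0) :
    fderiv ℝ exp w h = Real.sinc ‖w‖ • h :=
  fderiv_exp_apply_of_anticommute hw (mul_eq_neg_mul_of_inner_eq_zero hw hh hwh)

end ExpDeriv

/-! ## 4. The left-trivialised differential of the logarithm: `D qlog(e^w)(e^w x) = N_w x` -/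

section LogDeriv

/-- `ψ(θ) = 1 − θ cot θ`, written `1 − cos θ / sinc θ` so that `ψ 0 = 0`. [folklore] -/
def ψ (θ : ℝ) : ℝ := 1 - Real.cos θ / Real.sinc θ

/-- `ψ 0 = 0`. [folklore] -/
@[simp] theorem ψ_zero : ψ 0 = 0 := by simp [ψ, Real.sinc_zero]

/-- `ψ θ = 1 − θ cos θ / sin θ` for `θ ≠ 0`. [folklore] -/
theorem ψ_of_ne_zero {θ : ℝ} (hθ : θ ≠ 0) : ψ θ = 1 - θ * Real.cos θ / Real.sin θ := by
  rw [ψ, Real.sinc_of_ne_zero hθ, div_div_eq_mul_div, mul_comm (Real.cos θ) θ]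

/-- `(1 − ψ θ) sinc θ = cos θ` when `sinc θ ≠ 0`. [folklore] -/
theorem one_sub_ψ_mul_sinc {θ : ℝ} (h : Real.sinc θ ≠ 0) : (1 - ψ θ) * Real.sinc θ = Real.cos θ := by
  rw [ψ, sub_sub_cancel, div_mul_cancel₀ _ h]

/-- The component of `x` along `w`: `(⟨w, x⟩ / ‖w‖²) w` (zero for `w = 0`). [folklore] -/
def par (w x : ℍ) : ℍ := (⟪w, x⟫ / ‖w‖ ^ 2) • w

/-- The component of `x` orthogonal to `w`: `x − par_w x`. [folklore] -/
def perp (w x : ℍ) : ℍ := x - par w x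

/-- `par_w x + perp_w x = x`. [folklore] -/
@[simp] theorem par_add_perp (w x : ℍ) : par w x + perp w x = x := add_sub_cancel _ _

/-- `par_0 x = 0`. [folklore] -/
@[simp] theorem par_zero_left (x : ℍ) : par 0 x = 0 := smul_zero _

/-- `perp_0 x = x`. [folklore] -/
@[simp] theorem perp_zero_left (x : ℍ) : perp 0 x = x := by simp [perp]

/-- `perp_w x ⊥ w`. [folklore] -/
theorem inner_perp (w x : ℍ) : ⟪w, perp w x⟫ = 0 := by
  rcases eq_or_ne w 0 with rfl | hw
  · simp
  · rw [perp, par, inner_sub_right, inner_smul_right, real_inner_self_eq_norm_sq,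
      div_mul_cancel₀ _ (pow_ne_zero 2 (norm_ne_zero_iff.2 hw)), sub_self]

/-- `par_w x` is imaginary for imaginary `w`. [folklore] -/
theorem par_re {w : ℍ} (hw : w.re = 0) (x : ℍ) : (par w x).re = 0 := by
  simp [par, hw]

/-- `perp_w x` is imaginary for imaginary `w, x`. [folklore] -/
theorem perp_re {w x : ℍ} (hw : w.re = 0) (hx : x.re = 0) : (perp w x).re = 0 := by
  simp [perp, par, hw, hx]

/-- `w · perp_w x = w x + ⟨w, x⟩` for imaginary `w` (`w² = −‖w‖²`). [folklore] -/
theorem mul_perp {w : ℍ} (hw : w.re = 0) (x : ℍ) : w * perp w x = w * x + ((⟪w, x⟫ : ℝ) : ℍ) := by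
  rcases eq_or_ne w 0 with rfl | hw0
  · simp
  · have hθ : (‖w‖ : ℝ) ^ 2 ≠ 0 := pow_ne_zero 2 (norm_ne_zero_iff.2 hw0)
    have hww : w * w = -(((‖w‖ ^ 2 : ℝ)) : ℍ) := by
      rw [← sq, Quaternion.sq_eq_neg_normSq.2 hw, Quaternion.normSq_eq_norm_mul_self, sq]
    rw [perp, par, mul_sub, mul_smul_comm, hww, smul_neg, sub_neg_eq_add, Quaternion.smul_coe, div_mul_cancel₀ _ hθ]

/-- Imaginary orthogonal `w, p`: `w (w p) = −(w p) w`. [folklore] -/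
theorem mul_mul_eq_neg_of_anticommute {w p : ℍ} (h : w * p = -(p * w)) : w * (w * p) = -(w * p * w) := by
  conv_rhs => rw [mul_assoc, ← mul_neg, ← h]

/-- THE LEFT-TRIVIALISED DIFFERENTIAL OF THE LOGARITHM (candidate): `N_w x = x_∥ + θ cot θ · x_⊥ + w · x_⊥`, `θ = ‖w‖`. [folklore] -/
def N (w x : ℍ) : ℍ := par w x + (1 - ψ ‖w‖) • perp w x + w * perp w x

/-- `N_0 = id`. [folklore] -/
@[simp] theorem N_zero_left (x : ℍ) : N 0 x = x := by simp [N]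

/-- `‖e^w‖ = 1` for imaginary `w`. [folklore] -/
theorem norm_exp_of_re_eq_zero {w : ℍ} (hw : w.re = 0) : ‖exp w‖ = 1 := by
  rw [Quaternion.norm_exp, hw, NormedSpace.exp_zero, norm_one]

/-- `re e^w = cos ‖w‖` for imaginary `w`. [folklore] -/
theorem exp_re_of_re_eq_zero {w : ℍ} (hw : w.re = 0) : (exp w).re = Real.cos ‖w‖ := by
  rw [Quaternion.exp_of_re_eq_zero w hw]
  simp [hw]

/-- `‖e^w − 1‖ ≤ ‖w‖` for imaginary `w` (`‖e^w − 1‖² = 2 − 2 cos ‖w‖ ≤ ‖w‖²`). [folklore] -/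
theorem norm_exp_sub_one_le {w : ℍ} (hw : w.re = 0) : ‖exp w - 1‖ ≤ ‖w‖ := by
  have h1 : ⟪exp w, (1 : ℍ)⟫ = Real.cos ‖w‖ := by
    rw [Quaternion.inner_def, star_one, mul_one, exp_re_of_re_eq_zero hw]
  have hsq : ‖exp w - 1‖ ^ 2 ≤ ‖w‖ ^ 2 := by
    rw [norm_sub_sq_real, norm_exp_of_re_eq_zero hw, h1, norm_one]
    have := Real.one_sub_sq_div_two_le_cos (x := ‖w‖)
    linarith
  exact (pow_le_pow_iff_left₀ (norm_nonneg _) (norm_nonneg _) two_ne_zero).1 hsq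

/-- THE KEY IDENTITY `D exp(w) (N_w x) = e^w · x` for imaginary `w, x` with `‖w‖ < π` (on `x_∥`: commuting direction;
on `x_⊥` and `w x_⊥`: anticommuting directions, `D exp(w) = sinc θ`, and `(θ cot θ) sinc θ = cos θ`; closed form of `e^w`). [folklore] -/
theorem fderiv_exp_apply_N {w x : ℍ} (hw : w.re = 0) (hwπ : ‖w‖ < Real.pi) (hx : x.re = 0) :
    fderiv ℝ exp w (N w x) = exp w * x := by
  rcases eq_or_ne w 0 with rfl | hw0
  · rw [N_zero_left, (hasFDerivAt_exp_zero (𝕂 := ℝ) (𝔸 := ℍ)).fderiv, NormedSpace.exp_zero, one_mul]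
    rfl
  have hθ : 0 < ‖w‖ := norm_pos_iff.2 hw0
  have hsin : 0 < Real.sin ‖w‖ := Real.sin_pos_of_pos_of_lt_pi hθ hwπ
  have hsinc : Real.sinc ‖w‖ = Real.sin ‖w‖ / ‖w‖ := Real.sinc_of_ne_zero hθ.ne'
  have hsinc0 : Real.sinc ‖w‖ ≠ 0 := by rw [hsinc]; positivity
  set p := perp w x with hp_def
  have hp_re : p.re = 0 := perp_re hw hx
  have hp_inner : ⟪w, p⟫ = 0 := inner_perp w x
  have hanti : w * p = -(p * w) := mul_eq_neg_mul_of_inner_eq_zero hw hp_re hp_inner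
  -- the three pieces
  have h1 : fderiv ℝ exp w (par w x) = exp w * par w x := by
    unfold par
    rw [fderiv_exp_apply_of_commute ((Commute.refl w).smul_right _)]
    exact (((Commute.refl w).smul_right (⟪w, x⟫ / ‖w‖ ^ 2)).exp_left).eq.symm
  have h2 : fderiv ℝ exp w p = Real.sinc ‖w‖ • p := fderiv_exp_apply_of_anticommute hw hanti
  have h3 : fderiv ℝ exp w (w * p) = Real.sinc ‖w‖ • (w * p) :=
    fderiv_exp_apply_of_anticommute hw (mul_mul_eq_neg_of_anticommute hanti)
  -- assemble
  have hx' : x = par w x + p := (par_add_perp w x).symm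
  have hexp_p : exp w * p = Real.cos ‖w‖ • p + (Real.sin ‖w‖ / ‖w‖) • (w * p) := by
    rw [Quaternion.exp_of_re_eq_zero w hw, add_mul, Quaternion.coe_mul_eq_smul, smul_mul_assoc]
  calc fderiv ℝ exp w (N w x)
      = fderiv ℝ exp w (par w x) + (1 - ψ ‖w‖) • fderiv ℝ exp w p + fderiv ℝ exp w (w * p) := by
        rw [N, ← hp_def, map_add, map_add, map_smul]
    _ = exp w * par w x + ((1 - ψ ‖w‖) * Real.sinc ‖w‖) • p + Real.sinc ‖w‖ • (w * p) := by
        rw [h1, h2, h3, smul_smul]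
    _ = exp w * par w x + exp w * p := by
        rw [one_sub_ψ_mul_sinc hsinc0, hexp_p, hsinc, add_assoc]
    _ = exp w * x := by rw [← mul_add, ← hx']

/-- `D exp(Y)` IS INJECTIVE at an imaginary `Y` with `‖Y‖ < π` (kernel: split `z = re z + z_∥ + z_⊥`; the `z_⊥`-component of
`D exp(Y) z` is `sinc θ · z_⊥` with `sinc θ ≠ 0`, the rest is `(re z + z_∥) e^Y` with `e^Y` a unit). [folklore] -/
theorem fderiv_exp_injective_of_re_eq_zero {Y : ℍ} (hY : Y.re = 0) (hπ : ‖Y‖ < Real.pi) :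
    Function.Injective (fderiv ℝ exp Y) := by
  rcases eq_or_ne Y 0 with rfl | hY0
  · rw [(hasFDerivAt_exp_zero (𝕂 := ℝ) (𝔸 := ℍ)).fderiv]
    exact fun a b h => h
  have hθ : 0 < ‖Y‖ := norm_pos_iff.2 hY0
  have hsinc0 : Real.sinc ‖Y‖ ≠ 0 := by
    rw [Real.sinc_of_ne_zero hθ.ne']
    exact (div_pos (Real.sin_pos_of_pos_of_lt_pi hθ hπ) hθ).ne'
  rw [injective_iff_map_eq_zero]
  intro z hz
  -- decomposition of `z`
  set zi : ℍ := z.im with hzi_def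
  have hzi : zi.re = 0 := Quaternion.re_im z
  set p := perp Y zi with hp_def
  have hp_re : p.re = 0 := perp_re hY hzi
  have hp_inner : ⟪Y, p⟫ = 0 := inner_perp Y zi
  have hz_dec : z = ((z.re : ℝ) : ℍ) + par Y zi + p := by
    rw [add_assoc, par_add_perp, hzi_def, Quaternion.re_add_im]
  have hanti : Y * p = -(p * Y) := mul_eq_neg_mul_of_inner_eq_zero hY hp_re hp_inner
  have hc : Commute Y (((z.re : ℝ) : ℍ) + par Y zi) :=
    (Quaternion.coe_commute (z.re) Y).symm.add_right ((Commute.refl Y).smul_right _)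
  have hE : fderiv ℝ exp Y z = (((z.re : ℝ) : ℍ) + par Y zi) * exp Y + Real.sinc ‖Y‖ • p := by
    conv_lhs => rw [hz_dec]
    rw [map_add, fderiv_exp_apply_of_commute hc, fderiv_exp_apply_of_anticommute hY hanti]
  rw [hE] at hz
  -- the `p`-component: inner product with `p`
  have hp0 : p = 0 := by
    obtain ⟨a, b, hab⟩ : ∃ a b : ℝ, (((z.re : ℝ) : ℍ) + par Y zi) * exp Y = (a : ℍ) + b • Y := by
      refine ⟨z.re * Real.cos ‖Y‖ - (⟪Y, zi⟫ / ‖Y‖ ^ 2) * (Real.sin ‖Y‖ / ‖Y‖) * (Y.imI ^ 2 + Y.imJ ^ 2 + Y.imK ^ 2),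
        z.re * (Real.sin ‖Y‖ / ‖Y‖) + (⟪Y, zi⟫ / ‖Y‖ ^ 2) * Real.cos ‖Y‖, ?_⟩
      rw [Quaternion.exp_of_re_eq_zero Y hY]
      unfold par
      generalize ⟪Y, zi⟫ / ‖Y‖ ^ 2 = c
      generalize Real.sin ‖Y‖ / ‖Y‖ = sn
      generalize Real.cos ‖Y‖ = cs
      generalize z.re = r
      ext <;> simp [hY, sq] <;> ring
    have hA : ⟪(((z.re : ℝ) : ℍ) + par Y zi) * exp Y, p⟫ = 0 := by
      rw [hab, inner_add_left, inner_smul_left, hp_inner, mul_zero, add_zero, Quaternion.inner_def]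
      simp [hp_re]
    have := congrArg (fun q => ⟪q, p⟫) hz
    simp only [inner_add_left, inner_smul_left, hA, inner_zero_left, zero_add, real_inner_self_eq_norm_sq,
      RCLike.conj_to_real] at this
    have h2 : ‖p‖ ^ 2 = 0 := by
      rcases mul_eq_zero.1 this with h | h
      · exact absurd h hsinc0
      · exact h
    exact norm_eq_zero.1 (pow_eq_zero_iff two_ne_zero |>.1 h2)
  rw [hp0, smul_zero, add_zero] at hz
  -- the rest: `(re z + z_∥) e^Y = 0` with `e^Y` of norm one
  have hB : ((z.re : ℝ) : ℍ) + par Y zi = 0 := by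
    have := congrArg norm hz
    rwa [norm_mul, norm_exp_of_re_eq_zero hY, mul_one, norm_zero, norm_eq_zero] at this
  have hre : z.re = 0 := by
    have := congrArg (fun q : ℍ => q.re) hB
    simpa [par_re hY] using this
  have hpar : par Y zi = 0 := by
    rwa [hre, Quaternion.coe_zero, zero_add] at hB
  rw [hz_dec, hre, hpar, hp0]
  simp

/-- `D qlog(u) (u · x) = N_{qlog u} x` for a unit quaternion `u` with `‖u − 1‖ < 1/2` and imaginary `x`: apply `D qlog(u)` to the key
identity at `w = qlog u` (imaginary, `‖w‖ < 1 < π`, `e^w = u`) and use `D qlog(u) ∘ D exp(qlog u) = id`. [folklore] -/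
theorem fderiv_qlog_apply_mul {u x : ℍ} (hu1 : ‖u‖ = 1) (hu : ‖u - 1‖ < 1 / 2) (hx : x.re = 0) :
    fderiv ℝ qlog u (u * x) = N (qlog u) x := by
  have hu' : ‖u - 1‖ < 1 := lt_trans hu (by norm_num)
  have hw : (qlog u).re = 0 := qlog_re_of_norm_eq_one hu1 hu'
  have hwπ : ‖qlog u‖ < Real.pi := lt_trans (norm_qlog_lt_one hu) (by linarith [Real.pi_gt_three])
  have h := fderiv_qlog_apply_fderiv_exp hu' (N (qlog u) x)
  rwa [fderiv_exp_apply_N hw hwπ hx, exp_qlog hu'] at h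

/-- `‖perp_w x‖² = ‖x‖² − ⟨w, x⟩² / ‖w‖²`. [folklore] -/
theorem norm_perp_sq (w x : ℍ) : ‖perp w x‖ ^ 2 = ‖x‖ ^ 2 - ⟪w, x⟫ ^ 2 / ‖w‖ ^ 2 := by
  rcases eq_or_ne w 0 with rfl | hw0
  · simp
  · have hθ : (‖w‖ : ℝ) ^ 2 ≠ 0 := pow_ne_zero 2 (norm_ne_zero_iff.2 hw0)
    rw [perp, par, norm_sub_sq_real, inner_smul_right, real_inner_comm x w, norm_smul, mul_pow, Real.norm_eq_abs,
      sq_abs]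
    field_simp
    ring

/-- `⟨w · perp_w x, x⟩ = 0` for imaginary `w, x`. [folklore] -/
theorem inner_mul_perp {w x : ℍ} (hw : w.re = 0) (hx : x.re = 0) : ⟪w * perp w x, x⟫ = 0 := by
  unfold perp par
  generalize ⟪w, x⟫ / ‖w‖ ^ 2 = c
  rw [Quaternion.inner_def]
  simp [hw, hx]
  ring

/-- THE QUADRATIC FORM OF `N`: `⟨N_w x, x⟩ = ‖x‖² − ψ(‖w‖) ‖perp_w x‖²` for imaginary `w, x`. [folklore] -/
theorem inner_N_self {w x : ℍ} (hw : w.re = 0) (hx : x.re = 0) :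
    ⟪N w x, x⟫ = ‖x‖ ^ 2 - ψ ‖w‖ * ‖perp w x‖ ^ 2 := by
  have hpar : ⟪par w x, x⟫ = ⟪w, x⟫ ^ 2 / ‖w‖ ^ 2 := by
    rw [par, inner_smul_left, RCLike.conj_to_real]
    ring
  have hperp : ⟪perp w x, x⟫ = ‖x‖ ^ 2 - ⟪w, x⟫ ^ 2 / ‖w‖ ^ 2 := by
    rw [perp, inner_sub_left, real_inner_self_eq_norm_sq, hpar]
  rw [N, inner_add_left, inner_add_left, inner_smul_left, RCLike.conj_to_real, hpar, hperp, inner_mul_perp hw hx,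
    norm_perp_sq]
  ring

end LogDeriv



end Literature.MathematicalPhysics.QuantumFieldTheory.Balaban1983to89.T4QuatExpLog

end
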